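import Summits.ResolutionOfSingularities.ResolutionOfSingularities.Theorems.MarkedTransferCampaignW36Thm614Part1ExactOnClass
import Literature.AlgebraicGeometry.Hironaka2017.Proofs.S06BaseHike.SingRegularExact
import HarnessLib

/-!
# [OURS · L1 W3.6 ↔ GAP-LEDGER R20 sub 20a] THE GUARD ⟨DimUsc⟩ OF `…W36Thm614Part1ExactOnClass` (p506474) IS A THEOREM ON EVERY AMBIENT DATUM
# (SEAT 2's p506263 `S06BaseHike.exists_nhds_ringKrullDim_quotient_stalkIdeal_le`), SO 20a IS EXACT BY NAME WITH NO SIDE CONDITION: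
# on every sub-class of the W3.6 door's class, `CampaignW36.Thm614Part1On 𝒞 ⟺ HatClosureRegularOn 𝒞 ⟺ CoreFocusSingRegularOn 𝒞`, and ONE realized
# member with singular `Σ̄_max(Ê)` refutes both `p`-slices of 20a on its class — the guard-free re-binding of every statement of p506474

Cell `res-hironaka`, rung L (rescue), row L-G3, slot W3.6 ↔ GAP-LEDGER R20. Typed by the OURS typer o4 (statement-only lane); kernel plumbing only
(0 definitions), companion of p506474 `…W36Thm614Part1ExactOnClass` (class guards `CampaignW36.DimUscOn` / `DimUscClosureClass` / `DimUscPart`,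
guarded exactness `thm614Part1On_iff_hatClosureRegularOn (hle) …`). HOST (custody, no new route): `--supports stmt-ResolutionOfSingularities-16155 --as helper`.

WHY (records on the cell's STATUS.md). Minutes after p506474 re-based the class guard on SEAT 2's one-sided dimension binder ⟨hdimle⟩ (AMENDMENT
06:30:40Z; res-adj-3 RE-CITE #3 06:32:47Z: «⟨hdimle⟩ — a GENERAL FACT about closed subsets of Z, TRUE, NOT YET A KERNEL — library debt»; «RE-CITE #4 is
mechanical when EITHER k5 OR one general kernel `∀ C : Closeds A.Z, DimUscOn C` lands»), SEAT 2 (res-D-pv-027 AS res-L1-s36-pv-4) LANDED that general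
kernel: p505793 `Lib/HeightSemicontinuity` + **p506263 `Proofs/S06BaseHike/SingRegularExact.lean`** — `exists_nhds_ringKrullDim_quotient_stalkIdeal_le (A)
(C : Closeds A.Z)` (upper semicontinuity of the closed-point local dimension of EVERY closed `C ⊆ Z`; = `CampaignW36.DimUscOn C` VERBATIM at `W := A.Z`),
`isRegular_sing_of_Thm6_14_1` / `Thm6_14_1_iff_isRegular_sing'` (+ `_R1'`, `_R2'`) with NO side condition (D-LANDED 06:49:07Z «T-ASK k5 DELIVERED»).
This file discharges the guard BY NAME and restates every §3/§4/§5 statement of p506474 without its `hle` / `hdimle` binder (primed names, SEAT 2's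
convention); no new definition, no new mathematics — one term `dimUscOn_ambient A C := exists_nhds_ringKrullDim_quotient_stalkIdeal_le A C` does all the work.
* §1 `CampaignW36.dimUscOn_ambient (A) (C : Closeds A.Z) : DimUscOn C`; `dimUscClosureClass_ambient`; `dimUscPart_iff_ambient` (`DimUscPart 𝒞 = 𝒞` on
  ambient data, pointwise).
* §2 guard-free exactness on the class (parametric `𝒞`, `IsEdgeData`, `IsEdgeData'`): `isRegular_sing_of_thm614Part1On'` (necessity at every typed core
  focus, no door), `hatClosureRegularOn_of_thm614Part1On' (hspan) (hex)`, **`thm614Part1On_iff_hatClosureRegularOn' (hex) (hread) (hspan)`**,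
  `thm614Part1On_iff_coreFocusSingRegularOn'`; DNF-half carrier `not_thm614Part1On_of_singular_member` (one realized member + a typed core focus with
  NON-regular `Sing(Ě)`).
* §3 binder-free `p`-slices: `not_campaignW36Thm614Part1OnI_of_singular_member`, `…_of_singular_closure'` (`Ě` from the door p494780),
  **`not_campaignW36Thm614Part1OnI_lciClass_of_singular_closure'`** (SEAT 1's F5 shape, road (b): the cross datum + `LCIClass Ê Σ_max` + `Σ̄_max(Ê)` NOT
  regular ⇒ `¬ CampaignW36Thm614Part1OnI LCIClass p ∧ ¬ CampaignW36Thm614Part1OnR2I LCIClass p` — NO dimension side condition);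
  `campaignW36Thm614Part1OnI_iff_hatClosureRegularOnI' 𝒞 p (hdoor)`, `…_iff_coreFocusSingRegularOnI' 𝒞 p (hdoor)`, and UNCONDITIONAL
  **`campaignW36Thm614Part1OnI_iff_of_le_lciOrMonomial 𝒞 p (hlm : 𝒞 ≤ LCIOrMonomialClass)`** (both slices ⟺ `CampaignW36HatClosureRegularOnI 𝒞 p`),
  instances `campaignW36Thm614Part1OnI_lciOrMonomialClass_iff p`, `campaignW36Thm614Part1OnI_lciClass_iff p`.
NET FOR THE WORD (res-adj-3's to say; RE-CITE #4): on every sub-class `𝒞` of the door's class `LCIOrMonomialClass`, for every prime `p`, 20a in BOTH readings of the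
produced data ⟺ ⟨HatClosureRegular⟩ on `𝒞` ⟺ «`Ě` exists with regular `Sing(Ě)`» on `𝒞` — BY NAME, binder-free, no side condition; ✓ on
`RegularClosureClass` (p498576/p501108), pre-declared ✗ on `LCIClass` at `p = 2` at SEAT 1's cross (§3 carries it once SEAT 1 certifies membership +
non-regularity of `V(z, xy)`).

HONEST FRAMING. Every declaration below is kernel plumbing over OUR typed class Props (p487786 / p498576 / p501108 / p506474) and SEAT 2's kernels; NOTHING
here is a statement of H. Hironaka's manuscript (2017-03-23, [Hironaka2017], lit key `paper:url-3343fd9e678b`); `Thm6_14_1` (row 040a's typed CANDIDATE)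
enters only inside the HYPOTHESIS-shape class predicate `Thm614Part1On`; nothing asserts that Th. 6.14 (1) p.34 l.11–17 holds or fails as printed. AI
typing, weaker than expert review.
Reference (context only, not a premise): H. Hironaka, ms. 2017-03-23, §6.3 Th. 6.14 (1) p.34 l.11–17; §6.2 Eq. (43) p.30 l.4–9. [Hironaka2017]
-/

noncomputable section

set_option linter.dupNamespace false -- mandated namespace of this single-conjunct summit

open _root_.AlgebraicGeometry _root_.TopologicalSpace
namespace Summit.ResolutionOfSingularities.ResolutionOfSingularities.Theorems

open Literature.AlgebraicGeometry.Resolution Literature.AlgebraicGeometry.Hironaka2017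
open Literature.AlgebraicGeometry.Hironaka2017.S02Preliminaries Literature.AlgebraicGeometry.Hironaka2017.S04CharAlgebra
open Literature.AlgebraicGeometry.Hironaka2017.S06BaseHike Literature.AlgebraicGeometry.Hironaka2017.Datum
open Scheme.IdealSheafData IsLocalRing

universe u

namespace CampaignW36

/-! ## §1 The guard is a theorem on ambient data -/
section Discharge

variable {p : ℕ} [Fact p.Prime] {K : Type u} [Field K] [CharP K p]

/-- **⟨DimUsc⟩ HOLDS for every closed subset of the ambient scheme** — SEAT 2's p506263
`S06BaseHike.exists_nhds_ringKrullDim_quotient_stalkIdeal_le` by name (upper semicontinuity of the closed-point local dimension; `Lib/HeightSemicontinuity`).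
[folklore] -/
theorem dimUscOn_ambient (A : AmbientDatum p K) (C : Closeds A.Z) : DimUscOn C :=
  exists_nhds_ringKrullDim_quotient_stalkIdeal_le A C

/-- **`DimUscClosureClass` is ALL of `(F, Σ)` on an ambient datum.** [folklore] -/
theorem dimUscClosureClass_ambient (A : AmbientDatum p K) (F : IdealExponent A.Z) (Sig : Set A.Z) : DimUscClosureClass F Sig :=
  dimUscOn_ambient A (Closeds.closure Sig)

/-- **`DimUscPart 𝒞 = 𝒞` on an ambient datum** (pointwise). [folklore] -/
theorem dimUscPart_iff_ambient (𝒞 : ∀ ⦃W : Scheme.{u}⦄, IdealExponent W → Set W → Prop) (A : AmbientDatum p K)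
    (F : IdealExponent A.Z) (Sig : Set A.Z) : DimUscPart 𝒞 F Sig ↔ 𝒞 F Sig :=
  ⟨fun h => h.1, fun h => ⟨h, dimUscClosureClass_ambient A F Sig⟩⟩

end Discharge

/-! ## §2 Guard-free exactness on the class -/
section Exact

variable {𝒞 : ∀ ⦃W : Scheme.{u}⦄, IdealExponent W → Set W → Prop}
  {IsEdgeData IsEdgeData' : ∀ ⦃X : Scheme.{u}⦄ ⦃p n : ℕ⦄ (E : IdealExponent X) (ξ : X), EdgeDatumAt p n E ξ → Prop}
  {p : ℕ} [Fact p.Prime] {K : Type u} [Field K] [CharP K p] [PerfectField K] {A : AmbientDatum p K} {n : ℕ}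

/-- **NECESSITY at every typed core focus, NO side condition, NO door**: 20a on `𝒞` (produced data read in a provenance with degree-one spanning) ⇒
every typed core focus of every realized member of `𝒞` has REGULAR `Sing(Ě)` (p506474 `isRegular_sing_of_thm614Part1On` with its guard discharged;
equivalently SEAT 2's p506263 `isRegular_sing_of_Thm6_14_1`). [folklore] -/
theorem isRegular_sing_of_thm614Part1On'
    (hspan : ∀ (F : IdealExponent A.Z) (η : A.Z) (D : EdgeDatumAt p n F η), IsEdgeData' F η D →
      ∀ b ∈ stalkIdeal (pAlg F 1) η, b ∈ maximalIdeal (A.Z.presheaf.stalk η) →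
        ∃ c : Fin D.r → A.Z.presheaf.stalk η, (∀ j, D.expo j ≠ 0 → c j = 0) ∧
          b - ∑ j, c j * D.g j ∈ maximalIdeal (A.Z.presheaf.stalk η) ^ 2)
    (h : Thm614Part1On 𝒞 IsEdgeData IsEdgeData' A n)
    (E : IdealExponent A.Z) (ed : EdgeDataOn p n (baseHike E)) (hE : E.IsStandard) (hb : 0 < (baseHike E).b)
    (hed : IsEdgeDataOn IsEdgeData (baseHike E) ed)
    (hC : 𝒞 (baseHike E) (invmaxStratum ((baseHike E).sing ∩ S02Preliminaries.closedPoints A.Z) (invField (baseHike E) ed)))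
    {Echeck : IdealExponent A.Z} (hEc : IsCoreFocus_inst (baseHike E) Echeck ed) :
    Scheme.IsRegular (vanishingIdeal (⟨Echeck.sing, A.isClosed_sing Echeck⟩ : Closeds A.Z)).subscheme :=
  isRegular_sing_of_thm614Part1On (fun F S _ => dimUscClosureClass_ambient A F S) hspan h E ed hE hb hed hC hEc

/-- **NECESSITY for the residual, NO side condition** (door supplies the typed core focus). [folklore] -/
theorem hatClosureRegularOn_of_thm614Part1On'
    (hspan : ∀ (F : IdealExponent A.Z) (η : A.Z) (D : EdgeDatumAt p n F η), IsEdgeData' F η D →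
      ∀ b ∈ stalkIdeal (pAlg F 1) η, b ∈ maximalIdeal (A.Z.presheaf.stalk η) →
        ∃ c : Fin D.r → A.Z.presheaf.stalk η, (∀ j, D.expo j ≠ 0 → c j = 0) ∧
          b - ∑ j, c j * D.g j ∈ maximalIdeal (A.Z.presheaf.stalk η) ^ 2)
    (hex : CoreFocusExistsOn 𝒞 IsEdgeData A n) (h : Thm614Part1On 𝒞 IsEdgeData IsEdgeData' A n) :
    HatClosureRegularOn 𝒞 IsEdgeData A n :=
  hatClosureRegularOn_of_thm614Part1On (fun F S _ => dimUscClosureClass_ambient A F S) hspan hex h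

/-- **20a IS EXACT ON THE CLASS, NO SIDE CONDITION — ⟨HatClosureRegular⟩ form**: for every class `𝒞` carrying the door (p487786 `CoreFocusExistsOn`;
PROVED on `LCIOrMonomialClass`, p494780), every input provenance `IsEdgeData`, every reading `IsEdgeData'` implied by R1 ∧ R2 (`hread`) with degree-one
spanning (`hspan`): `Thm614Part1On 𝒞 IsEdgeData IsEdgeData' A n ↔ HatClosureRegularOn 𝒞 IsEdgeData A n`. [folklore] -/
theorem thm614Part1On_iff_hatClosureRegularOn' (hex : CoreFocusExistsOn 𝒞 IsEdgeData A n)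
    (hread : ∀ (F : IdealExponent A.Z) (η : A.Z) (D : EdgeDatumAt p n F η),
      S04CharAlgebra.IsEdgeData D → IsEdgeData_alg D → IsEdgeData' F η D)
    (hspan : ∀ (F : IdealExponent A.Z) (η : A.Z) (D : EdgeDatumAt p n F η), IsEdgeData' F η D →
      ∀ b ∈ stalkIdeal (pAlg F 1) η, b ∈ maximalIdeal (A.Z.presheaf.stalk η) →
        ∃ c : Fin D.r → A.Z.presheaf.stalk η, (∀ j, D.expo j ≠ 0 → c j = 0) ∧
          b - ∑ j, c j * D.g j ∈ maximalIdeal (A.Z.presheaf.stalk η) ^ 2) :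
    Thm614Part1On 𝒞 IsEdgeData IsEdgeData' A n ↔ HatClosureRegularOn 𝒞 IsEdgeData A n :=
  thm614Part1On_iff_hatClosureRegularOn (fun F S _ => dimUscClosureClass_ambient A F S) hex hread hspan

/-- **20a IS EXACT ON THE CLASS, NO SIDE CONDITION — R20 form** («`Ě` exists with regular `Sing(Ě)`» on `𝒞`, p498576). [folklore] -/
theorem thm614Part1On_iff_coreFocusSingRegularOn' (hex : CoreFocusExistsOn 𝒞 IsEdgeData A n)
    (hread : ∀ (F : IdealExponent A.Z) (η : A.Z) (D : EdgeDatumAt p n F η),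
      S04CharAlgebra.IsEdgeData D → IsEdgeData_alg D → IsEdgeData' F η D)
    (hspan : ∀ (F : IdealExponent A.Z) (η : A.Z) (D : EdgeDatumAt p n F η), IsEdgeData' F η D →
      ∀ b ∈ stalkIdeal (pAlg F 1) η, b ∈ maximalIdeal (A.Z.presheaf.stalk η) →
        ∃ c : Fin D.r → A.Z.presheaf.stalk η, (∀ j, D.expo j ≠ 0 → c j = 0) ∧
          b - ∑ j, c j * D.g j ∈ maximalIdeal (A.Z.presheaf.stalk η) ^ 2) :
    Thm614Part1On 𝒞 IsEdgeData IsEdgeData' A n ↔ CoreFocusSingRegularOn 𝒞 IsEdgeData A n :=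
  thm614Part1On_iff_coreFocusSingRegularOn (fun F S _ => dimUscClosureClass_ambient A F S) hex hread hspan

/-- **ONE MEMBER KILLS 20a ON THE CLASS, NO SIDE CONDITION**: a realized member `(E, ed)` of `𝒞` (standard, `0 < Ê.b`, certified in `IsEdgeData`) with a
typed core focus whose `Sing(Ě)` is NOT regular refutes `Thm614Part1On 𝒞 IsEdgeData IsEdgeData'` for every reading with degree-one spanning. [folklore] -/
theorem not_thm614Part1On_of_singular_member
    (hspan : ∀ (F : IdealExponent A.Z) (η : A.Z) (D : EdgeDatumAt p n F η), IsEdgeData' F η D →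
      ∀ b ∈ stalkIdeal (pAlg F 1) η, b ∈ maximalIdeal (A.Z.presheaf.stalk η) →
        ∃ c : Fin D.r → A.Z.presheaf.stalk η, (∀ j, D.expo j ≠ 0 → c j = 0) ∧
          b - ∑ j, c j * D.g j ∈ maximalIdeal (A.Z.presheaf.stalk η) ^ 2)
    (E : IdealExponent A.Z) (ed : EdgeDataOn p n (baseHike E)) (hE : E.IsStandard) (hb : 0 < (baseHike E).b)
    (hed : IsEdgeDataOn IsEdgeData (baseHike E) ed)
    (hC : 𝒞 (baseHike E) (invmaxStratum ((baseHike E).sing ∩ S02Preliminaries.closedPoints A.Z) (invField (baseHike E) ed)))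
    {Echeck : IdealExponent A.Z} (hEc : IsCoreFocus_inst (baseHike E) Echeck ed)
    (hsing : ¬ Scheme.IsRegular (vanishingIdeal (⟨Echeck.sing, A.isClosed_sing Echeck⟩ : Closeds A.Z)).subscheme) :
    ¬ Thm614Part1On 𝒞 IsEdgeData IsEdgeData' A n :=
  not_thm614Part1On_of_member hspan E ed hE hb hed hC (dimUscClosureClass_ambient A _ _) hEc hsing

end Exact

end CampaignW36

open CampaignW36

/-! ## §3 Binder-free `p`-slices -/

/-- **ONE MEMBER KILLS BOTH `p`-SLICES OF 20a ON ITS CLASS, NO SIDE CONDITION**: a realized member of `𝒞` over some perfect field of characteristic `p`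
(input provenance `CampaignW31.edgeDataProvenance`) with a typed core focus whose `Sing(Ě)` is NOT regular gives
`¬ CampaignW36Thm614Part1OnI 𝒞 p ∧ ¬ CampaignW36Thm614Part1OnR2I 𝒞 p`. NOT a statement of the manuscript. [folklore] -/
theorem not_campaignW36Thm614Part1OnI_of_singular_member (𝒞 : ∀ ⦃W : Scheme.{u}⦄, IdealExponent W → Set W → Prop) (p : ℕ)
    [Fact p.Prime] (K : Type u) [Field K] [CharP K p] [PerfectField K] (A : AmbientDatum p K) (n : ℕ) (E : IdealExponent A.Z)
    (ed : EdgeDataOn p n (baseHike E)) (hE : E.IsStandard) (hb : 0 < (baseHike E).b)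
    (hed : IsEdgeDataOn CampaignW31.edgeDataProvenance (baseHike E) ed)
    (hC : 𝒞 (baseHike E) (invmaxStratum ((baseHike E).sing ∩ S02Preliminaries.closedPoints A.Z) (invField (baseHike E) ed)))
    {Echeck : IdealExponent A.Z} (hEc : IsCoreFocus_inst (baseHike E) Echeck ed)
    (hsing : ¬ Scheme.IsRegular (vanishingIdeal (⟨Echeck.sing, A.isClosed_sing Echeck⟩ : Closeds A.Z)).subscheme) :
    ¬ CampaignW36Thm614Part1OnI.{u} 𝒞 p ∧ ¬ CampaignW36Thm614Part1OnR2I.{u} 𝒞 p :=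
  not_campaignW36Thm614Part1OnI_of_member 𝒞 p K A n E ed hE hb hed hC (dimUscClosureClass_ambient A _ _) hEc hsing

/-- **THE CARRIER WITHOUT NAMING `Ě`, NO SIDE CONDITION**: a realized member of `𝒞` inside the door's class `LCIOrMonomialClass` whose `Σ̄_max(Ê)` is NOT
regular (`¬ CampaignW31.InvmaxClosureRegularOn`) kills both `p`-slices of 20a on `𝒞`. NOT a statement of the manuscript. [folklore] -/
theorem not_campaignW36Thm614Part1OnI_of_singular_closure' (𝒞 : ∀ ⦃W : Scheme.{u}⦄, IdealExponent W → Set W → Prop) (p : ℕ)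
    [Fact p.Prime] (K : Type u) [Field K] [CharP K p] [PerfectField K] (A : AmbientDatum p K) (n : ℕ) (E : IdealExponent A.Z)
    (ed : EdgeDataOn p n (baseHike E)) (hE : E.IsStandard) (hb : 0 < (baseHike E).b)
    (hed : IsEdgeDataOn CampaignW31.edgeDataProvenance (baseHike E) ed)
    (hC : 𝒞 (baseHike E) (invmaxStratum ((baseHike E).sing ∩ S02Preliminaries.closedPoints A.Z) (invField (baseHike E) ed)))
    (hlm : LCIOrMonomialClass (baseHike E)
      (invmaxStratum ((baseHike E).sing ∩ S02Preliminaries.closedPoints A.Z) (invField (baseHike E) ed)))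
    (hsing : ¬ CampaignW31.InvmaxClosureRegularOn ((baseHike E).sing ∩ S02Preliminaries.closedPoints A.Z)
      (invField (baseHike E) ed)) :
    ¬ CampaignW36Thm614Part1OnI.{u} 𝒞 p ∧ ¬ CampaignW36Thm614Part1OnR2I.{u} 𝒞 p :=
  not_campaignW36Thm614Part1OnI_of_singular_closure 𝒞 p K A n E ed hE hb hed hC hlm (dimUscClosureClass_ambient A _ _) hsing

/-- **SEAT 1's SHAPE, NO SIDE CONDITION (`𝒞 := LCIClass`)**: an A-type member (`LCIClass Ê Σ_max`, e.g. `Σ̄_max` a singular complete-intersection cut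
such as the cross `V(z, xy) ⊂ 𝔸³`) with NON-regular `Σ̄_max(Ê)`, over some perfect `K` of characteristic `p`, gives
`¬ CampaignW36Thm614Part1OnI LCIClass p ∧ ¬ CampaignW36Thm614Part1OnR2I LCIClass p` — 20a|`LCIClass` DOES-NOT-FOLLOW-AS-TYPED at that instance, by name.
NOT a statement of the manuscript; no member is certified IN THIS FILE. [folklore] -/
theorem not_campaignW36Thm614Part1OnI_lciClass_of_singular_closure' (p : ℕ) [Fact p.Prime] (K : Type u) [Field K] [CharP K p]
    [PerfectField K] (A : AmbientDatum p K) (n : ℕ) (E : IdealExponent A.Z) (ed : EdgeDataOn p n (baseHike E)) (hE : E.IsStandard)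
    (hb : 0 < (baseHike E).b) (hed : IsEdgeDataOn CampaignW31.edgeDataProvenance (baseHike E) ed)
    (hC : LCIClass (baseHike E) (invmaxStratum ((baseHike E).sing ∩ S02Preliminaries.closedPoints A.Z) (invField (baseHike E) ed)))
    (hsing : ¬ CampaignW31.InvmaxClosureRegularOn ((baseHike E).sing ∩ S02Preliminaries.closedPoints A.Z)
      (invField (baseHike E) ed)) :
    ¬ CampaignW36Thm614Part1OnI.{u} LCIClass p ∧ ¬ CampaignW36Thm614Part1OnR2I.{u} LCIClass p :=
  not_campaignW36Thm614Part1OnI_of_singular_closure' LCIClass p K A n E ed hE hb hed hC (lciClass_le _ _ hC) hsing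

/-- **20a IS EXACT, `p`-SLICES, NO SIDE CONDITION, for every class carrying the door** (`CampaignW36CoreFocusExistsOnI 𝒞 p`, p487786): both readings of the
produced data agree with ⟨HatClosureRegular⟩ on the class. NOT a statement of the manuscript. [folklore] -/
theorem campaignW36Thm614Part1OnI_iff_hatClosureRegularOnI' (𝒞 : ∀ ⦃W : Scheme.{u}⦄, IdealExponent W → Set W → Prop) (p : ℕ)
    [Fact p.Prime] (hdoor : CampaignW36CoreFocusExistsOnI.{u} 𝒞 p) :
    (CampaignW36Thm614Part1OnI.{u} 𝒞 p ↔ CampaignW36HatClosureRegularOnI.{u} 𝒞 p) ∧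
      (CampaignW36Thm614Part1OnR2I.{u} 𝒞 p ↔ CampaignW36HatClosureRegularOnI.{u} 𝒞 p) :=
  ⟨⟨fun h K _ _ _ A n => hatClosureRegularOn_of_thm614Part1On' (fun _ _ D hD => D.degOneSpan_of_isEdgeData hD) (hdoor K A n)
      (h K A n), fun h => (campaignW36Thm614Part1OnI_of_hatClosureRegularOnI 𝒞 p h).1⟩,
   ⟨fun h K _ _ _ A n => hatClosureRegularOn_of_thm614Part1On' (fun _ _ D hD => D.degOneSpan_of_isEdgeData_alg hD) (hdoor K A n)
      (h K A n), fun h => (campaignW36Thm614Part1OnI_of_hatClosureRegularOnI 𝒞 p h).2⟩⟩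

/-- **… and with R20's regime** («`Ě` exists with regular `Sing(Ě)`» on `𝒞`; p498576's unconditional bridge). NOT a statement of the manuscript. [folklore] -/
theorem campaignW36Thm614Part1OnI_iff_coreFocusSingRegularOnI' (𝒞 : ∀ ⦃W : Scheme.{u}⦄, IdealExponent W → Set W → Prop) (p : ℕ)
    [Fact p.Prime] (hdoor : CampaignW36CoreFocusExistsOnI.{u} 𝒞 p) :
    CampaignW36Thm614Part1OnI.{u} 𝒞 p ↔ CampaignW36CoreFocusSingRegularOnI.{u} 𝒞 p :=
  (campaignW36Thm614Part1OnI_iff_hatClosureRegularOnI' 𝒞 p hdoor).1.trans (campaignW36CoreFocusSingRegularOnI_iff 𝒞 p).symm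

/-- **UNCONDITIONAL on every sub-class of the door's class** (`𝒞 ≤ LCIOrMonomialClass`, door p494780): BOTH `p`-slices of 20a ⟺
`CampaignW36HatClosureRegularOnI 𝒞 p`, NO side condition. NOT a statement of the manuscript. [folklore] -/
theorem campaignW36Thm614Part1OnI_iff_of_le_lciOrMonomial (𝒞 : ∀ ⦃W : Scheme.{u}⦄, IdealExponent W → Set W → Prop) (p : ℕ)
    [Fact p.Prime] (hlm : ∀ ⦃W⦄ (F : IdealExponent W) (S : Set W), 𝒞 F S → LCIOrMonomialClass F S) :
    (CampaignW36Thm614Part1OnI.{u} 𝒞 p ↔ CampaignW36HatClosureRegularOnI.{u} 𝒞 p) ∧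
      (CampaignW36Thm614Part1OnR2I.{u} 𝒞 p ↔ CampaignW36HatClosureRegularOnI.{u} 𝒞 p) :=
  campaignW36Thm614Part1OnI_iff_hatClosureRegularOnI' 𝒞 p fun K _ _ _ A n =>
    coreFocusExistsOn_mono hlm (campaignW36CoreFocusExists_lciOrMonomial_holds p K A n)

/-- **UNCONDITIONAL on the door's class itself** (`LCIOrMonomialClass`, p488503). NOT a statement of the manuscript. [folklore] -/
theorem campaignW36Thm614Part1OnI_lciOrMonomialClass_iff (p : ℕ) [Fact p.Prime] :
    (CampaignW36Thm614Part1OnI.{u} LCIOrMonomialClass p ↔ CampaignW36HatClosureRegularOnI.{u} LCIOrMonomialClass p) ∧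
      (CampaignW36Thm614Part1OnR2I.{u} LCIOrMonomialClass p ↔ CampaignW36HatClosureRegularOnI.{u} LCIOrMonomialClass p) :=
  campaignW36Thm614Part1OnI_iff_of_le_lciOrMonomial LCIOrMonomialClass p fun _ _ _ h => h

/-- **UNCONDITIONAL on the A-type class `LCIClass`** (p488503; where SEAT 1's cross lives). NOT a statement of the manuscript. [folklore] -/
theorem campaignW36Thm614Part1OnI_lciClass_iff (p : ℕ) [Fact p.Prime] :
    (CampaignW36Thm614Part1OnI.{u} LCIClass p ↔ CampaignW36HatClosureRegularOnI.{u} LCIClass p) ∧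
      (CampaignW36Thm614Part1OnR2I.{u} LCIClass p ↔ CampaignW36HatClosureRegularOnI.{u} LCIClass p) :=
  campaignW36Thm614Part1OnI_iff_of_le_lciOrMonomial LCIClass p lciClass_le

end Summit.ResolutionOfSingularities.ResolutionOfSingularities.Theorems

end
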